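/-
Copyright (c) 2026 the pub-hodgecm-mathlib formalisation cell (harness21).  Prover seat hodgecm-mathlib-K2E3-p03 (g4), Track B «K2-LIT» ∕ h413
(`stmt-HodgeConjecture-24833`), line `K2_E3_EllipticInputs`, unit U12, §L leaf (LBGL-3E) (Richardson road, (F-E) ROAD v2 of K2E3-p11 (g5)), brick P″:
`Ad(K ∩ P)` PRESERVES THE LEBESGUE MEASURE OF THE (2,1)-PARABOLIC SUBALGEBRA `𝔭 ≅ F⁷` OF `𝔤𝔩₃(F)`.  2026-09-04.
-/
import Summits.HodgeConjecture.HodgeConjecture.Theorems.K2E3GLnLieAdIntegralInvariant   -- ★ p856… (K2E3-p12 g3): the lattice argument on `𝔤𝔩_N(F)`; `glInt`, `primePowBall` kits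
import HarnessLib

/-!
# K2_E3 road (h413), §L leaf (LBGL-3E), (F-E) ROAD v2 brick P″ — `∫_{F⁷} φ(p P(r) p⁻¹) dr = ∫_{F⁷} φ(P(r)) dr` for `p ∈ GL₃(𝒪) ∩ P_{(2,1)}`

Cell `pub/hodgecm-mathlib` (D-0151), Track B (21-frontier RULING «PUSH BOTH» 2026-09-03, director req624), seat K2E3-p03 (g4) (free E3 hand; brick P″
«HAND WANTED (S–M)» of the Richardson road owner K2E3-p11 (g5)'s (F-E) ROAD v2, squad bus 2026-09-04T05:41:53Z; dealer K2E3-plan (g3)).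
`--supports stmt-HodgeConjecture-24833 --as helper`; THEOREMS ONLY (no definition ∕ instance ∕ notation ∕ named fact ∕ `sorry`); never imports `Cruxes/…/Lines`.
COUNT-NEUTRAL: (LBGL-3E) `sig_K2E3GL3ParabolicSliceDensity` stays OPEN; this is the `Ad(K ∩ P)`-invariance input of the local pullback G″.

THE RESULT.  `F` a non-archimedean local field, `dx` an additive Haar measure on `F`, `𝔭 ⊂ 𝔤𝔩₃(F)` the block upper triangular subalgebra of type `(2,1)` in
the coordinates `P(r) = !![r 0, r 1, r 2; r 3, r 4, r 5; 0, 0, r 6]` (`r : Fin 7 → F`, Lebesgue measure `Measure.pi fun _ => dx`).  For `p ∈ K ∩ P` — `p ∈ GL₃(𝒪)`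
(`glInt 3 F`: integral entries, integral inverse) with `p 2 0 = p 2 1 = 0` —
* **`lintegral_pi_comp_conj_parabolic_eq`** — `∫⁻ r, φ (p · P(r) · p⁻¹) d(pi dx) = ∫⁻ r, φ (P(r)) d(pi dx)` for EVERY `φ : 𝔤𝔩₃(F) → [0, ∞]` (no measurability:
  the substitution is a measurable equivalence); `integral_pi_comp_conj_parabolic_eq` (Bochner form);
* `map_adParabolicCoord_eq_self` — the coordinate map `r ↦ coords(p P(r) p⁻¹)` preserves `pi dx`.
PROOF (the LATTICE ARGUMENT of ★ `K2E3GLnLieAdIntegralInvariant.map_conj_eq_self_of_mem_glInt`, now on `𝔭 ≅ F⁷`): `p` and `p⁻¹` are block upper triangular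
(`Matrix.blockTriangular_inv_of_blockTriangular`), so `Ad(p)` maps `𝔭` to itself and `T_p : r ↦ coords(p P(r) p⁻¹)` is a bi-continuous additive automorphism of
`F⁷` with inverse `T_{p⁻¹}`; hence `(T_p)_*(pi dx)` is an additive Haar measure, `= c • pi dx` (Mathlib `isAddLeftInvariant_eq_smul`); `p, p⁻¹` integral ⇒ `T_p`
maps the compact open box `𝒪⁷` onto itself, so `c = 1`.  [WeilBNT1967, Ch. I §2 Cor. 2 of Thm. 3, Ch. II §2; HarishChandra1999AdmissibleDistributions, §3 p. 8]
HONEST LABEL: HC_CM is proved only modulo the 7 printed citations (2 remaining named inputs: hLiu418 = stmt-HodgeConjecture-24832, h413 =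
stmt-HodgeConjecture-24833) until rung 0 closes; count-neutral helper.

## References
* [WeilBNT1967] A. Weil, *Basic Number Theory* (1967), Ch. I §2 (module of an automorphism), Ch. II §2.
* [HarishChandra1999AdmissibleDistributions] Harish-Chandra (DeBacker–Sally), *Admissible Invariant Distributions on Reductive p-adic Groups* (1999), §3 p. 8.
-/

set_option autoImplicit false
set_option linter.dupNamespace false   -- `Summit.HodgeConjecture.HodgeConjecture.…` (D-0017 nested layout; lakefile exemption for Summits)

noncomputable section

open MeasureTheory Measure Filter Topology
open scoped MatrixGroups NNReal ENNReal
open Literature.NumberTheory.Automorphic Literature.NumberTheory.Automorphic.LocalFieldHaar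
open Literature.NumberTheory.GaloisRepresentations Literature.NumberTheory.GaloisRepresentations.IsNonarchimedeanLocalField
open ValuativeRel

namespace Summit.HodgeConjecture.HodgeConjecture.Cruxes.H413.K2E3GL3ParabolicLieAdInvariant

/-! ## §1  Algebra of the (2,1)-parabolic coordinates (any commutative ring) -/

section Algebra

variable {R : Type*} [CommRing R]

/-- The coordinates `r ↦ P(r)` and `X ↦ (X₀₀, X₀₁, X₀₂, X₁₀, X₁₁, X₁₂, X₂₂)` are inverse on `𝔭 = {X | X 2 0 = X 2 1 = 0}`. [folklore] -/
theorem parabolic_of_coords {X : Matrix (Fin 3) (Fin 3) R} (h20 : X 2 0 = 0) (h21 : X 2 1 = 0) :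
    !![X 0 0, X 0 1, X 0 2; X 1 0, X 1 1, X 1 2; 0, 0, X 2 2] = X := by
  ext i j
  fin_cases i <;> fin_cases j <;> simp [h20, h21]

/-- `coords (P(r)) = r`. [folklore] -/
theorem coords_parabolic (r : Fin 7 → R) :
    ![(!![r 0, r 1, r 2; r 3, r 4, r 5; 0, 0, r 6] : Matrix (Fin 3) (Fin 3) R) 0 0, !![r 0, r 1, r 2; r 3, r 4, r 5; 0, 0, r 6] 0 1,
      !![r 0, r 1, r 2; r 3, r 4, r 5; 0, 0, r 6] 0 2, !![r 0, r 1, r 2; r 3, r 4, r 5; 0, 0, r 6] 1 0, !![r 0, r 1, r 2; r 3, r 4, r 5; 0, 0, r 6] 1 1,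
      !![r 0, r 1, r 2; r 3, r 4, r 5; 0, 0, r 6] 1 2, !![r 0, r 1, r 2; r 3, r 4, r 5; 0, 0, r 6] 2 2] = r := by
  funext i
  fin_cases i <;> simp

/-- `P(r)` is block upper triangular of type `(2,1)`. [folklore] -/
theorem blockTriangular_parabolic (r : Fin 7 → R) :
    (!![r 0, r 1, r 2; r 3, r 4, r 5; 0, 0, r 6] : Matrix (Fin 3) (Fin 3) R).BlockTriangular (![false, false, true] : Fin 3 → Bool) := by
  intro i j hij
  fin_cases i <;> fin_cases j <;> first | exact absurd hij (by decide) | simp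

/-- A block upper triangular matrix of type `(2,1)` has `X 2 0 = 0` and `X 2 1 = 0`. [folklore] -/
theorem apply_two_eq_zero_of_blockTriangular {X : Matrix (Fin 3) (Fin 3) R} (hX : X.BlockTriangular (![false, false, true] : Fin 3 → Bool)) :
    X 2 0 = 0 ∧ X 2 1 = 0 :=
  ⟨hX (by decide), hX (by decide)⟩

/-- `P(r) + P(s) = P(r + s)`. [folklore] -/
theorem parabolic_add (r s : Fin 7 → R) :
    (!![r 0, r 1, r 2; r 3, r 4, r 5; 0, 0, r 6] : Matrix (Fin 3) (Fin 3) R) + !![s 0, s 1, s 2; s 3, s 4, s 5; 0, 0, s 6] =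
      !![(r + s) 0, (r + s) 1, (r + s) 2; (r + s) 3, (r + s) 4, (r + s) 5; 0, 0, (r + s) 6] := by
  ext i j
  fin_cases i <;> fin_cases j <;> simp

end Algebra

/-! ## §2  The lattice argument on `𝔭 ≅ F⁷` -/

section Continuity

variable {F : Type*} [TopologicalSpace F] [CommRing F]

/-- `r ↦ P(r)` is continuous. [folklore] -/
theorem continuous_parabolic : Continuous fun r : Fin 7 → F => (!![r 0, r 1, r 2; r 3, r 4, r 5; 0, 0, r 6] : Matrix (Fin 3) (Fin 3) F) := by
  refine continuous_matrix fun i j => ?_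
  fin_cases i <;> fin_cases j <;> simp <;> fun_prop

omit [CommRing F] in
/-- `X ↦ coords X` is continuous. [folklore] -/
theorem continuous_coords : Continuous fun X : Matrix (Fin 3) (Fin 3) F => (![X 0 0, X 0 1, X 0 2, X 1 0, X 1 1, X 1 2, X 2 2] : Fin 7 → F) := by
  refine continuous_pi fun i => ?_
  fin_cases i <;> simp <;> fun_prop

end Continuity

section LocalField

variable {F : Type*} [Field F] [ValuativeRel F] [TopologicalSpace F] [IsNonarchimedeanLocalField F]
  [MeasurableSpace F] [BorelSpace F] (dx : Measure F) [dx.IsAddHaarMeasure]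

/-- **`Ad(p)` in parabolic coordinates preserves `pi dx`** for `p ∈ GL₃(𝒪) ∩ P_{(2,1)}`: the map
`T_p : r ↦ coords(p · P(r) · p⁻¹)` satisfies `(pi dx).map T_p = pi dx` (lattice argument on `F⁷`). [cite: WeilBNT1967, Ch. I §2 Cor. 2 of Thm. 3; Ch. II §2] -/
theorem map_adParabolicCoord_eq_self {p : GL (Fin 3) F} (hp : p ∈ glInt 3 F) (h20 : (p : Matrix (Fin 3) (Fin 3) F) 2 0 = 0)
    (h21 : (p : Matrix (Fin 3) (Fin 3) F) 2 1 = 0) :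
    (Measure.pi fun _ : Fin 7 => dx).map (fun r : Fin 7 → F =>
      (![((p : Matrix (Fin 3) (Fin 3) F) * !![r 0, r 1, r 2; r 3, r 4, r 5; 0, 0, r 6] * ((p⁻¹ : GL (Fin 3) F) : Matrix (Fin 3) (Fin 3) F)) 0 0,
         ((p : Matrix (Fin 3) (Fin 3) F) * !![r 0, r 1, r 2; r 3, r 4, r 5; 0, 0, r 6] * ((p⁻¹ : GL (Fin 3) F) : Matrix (Fin 3) (Fin 3) F)) 0 1,
         ((p : Matrix (Fin 3) (Fin 3) F) * !![r 0, r 1, r 2; r 3, r 4, r 5; 0, 0, r 6] * ((p⁻¹ : GL (Fin 3) F) : Matrix (Fin 3) (Fin 3) F)) 0 2,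
         ((p : Matrix (Fin 3) (Fin 3) F) * !![r 0, r 1, r 2; r 3, r 4, r 5; 0, 0, r 6] * ((p⁻¹ : GL (Fin 3) F) : Matrix (Fin 3) (Fin 3) F)) 1 0,
         ((p : Matrix (Fin 3) (Fin 3) F) * !![r 0, r 1, r 2; r 3, r 4, r 5; 0, 0, r 6] * ((p⁻¹ : GL (Fin 3) F) : Matrix (Fin 3) (Fin 3) F)) 1 1,
         ((p : Matrix (Fin 3) (Fin 3) F) * !![r 0, r 1, r 2; r 3, r 4, r 5; 0, 0, r 6] * ((p⁻¹ : GL (Fin 3) F) : Matrix (Fin 3) (Fin 3) F)) 1 2,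
         ((p : Matrix (Fin 3) (Fin 3) F) * !![r 0, r 1, r 2; r 3, r 4, r 5; 0, 0, r 6] * ((p⁻¹ : GL (Fin 3) F) : Matrix (Fin 3) (Fin 3) F)) 2 2] : Fin 7 → F)) =
      Measure.pi fun _ : Fin 7 => dx := by
  haveI : T2Space F := (isLocalField F).toT2Space
  haveI : LocallyCompactSpace F := (isLocalField F).toLocallyCompactSpace
  haveI : SecondCountableTopology F := secondCountableTopology_localField F
  -- notation-free abbreviations (local, proof-internal)
  set toP : (Fin 7 → F) → Matrix (Fin 3) (Fin 3) F := fun r => !![r 0, r 1, r 2; r 3, r 4, r 5; 0, 0, r 6] with htoP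
  set ofP : Matrix (Fin 3) (Fin 3) F → (Fin 7 → F) := fun X => ![X 0 0, X 0 1, X 0 2, X 1 0, X 1 1, X 1 2, X 2 2] with hofP
  set P : Matrix (Fin 3) (Fin 3) F := (p : Matrix (Fin 3) (Fin 3) F) with hPdef
  set Q : Matrix (Fin 3) (Fin 3) F := ((p⁻¹ : GL (Fin 3) F) : Matrix (Fin 3) (Fin 3) F) with hQdef
  have hQP : Q * P = 1 := by rw [hQdef, hPdef, ← Units.val_mul, inv_mul_cancel, Units.val_one]
  have hPQ : P * Q = 1 := by rw [hQdef, hPdef, ← Units.val_mul, mul_inv_cancel, Units.val_one]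
  -- block structure of `p` and `p⁻¹`
  have hPbt : P.BlockTriangular (![false, false, true] : Fin 3 → Bool) := by
    intro i j hij
    fin_cases i <;> fin_cases j <;> first | exact absurd hij (by decide) | exact h20 | exact h21
  have hQbt : Q.BlockTriangular (![false, false, true] : Fin 3 → Bool) := by
    haveI : Invertible P := p.invertible
    have h := Matrix.blockTriangular_inv_of_blockTriangular hPbt
    have hQinv : Q = P⁻¹ := by rw [hQdef, hPdef, Matrix.coe_units_inv]
    rw [hQinv]
    exact h
  have hconjP : ∀ r, (P * toP r * Q).BlockTriangular (![false, false, true] : Fin 3 → Bool) := fun r =>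
    (hPbt.mul (blockTriangular_parabolic r)).mul hQbt
  have hconjQ : ∀ r, (Q * toP r * P).BlockTriangular (![false, false, true] : Fin 3 → Bool) := fun r =>
    (hQbt.mul (blockTriangular_parabolic r)).mul hPbt
  have htoP_ofP : ∀ X : Matrix (Fin 3) (Fin 3) F, X.BlockTriangular (![false, false, true] : Fin 3 → Bool) → toP (ofP X) = X := by
    intro X hX
    obtain ⟨h0, h1⟩ := apply_two_eq_zero_of_blockTriangular hX
    exact parabolic_of_coords h0 h1
  have hofP_toP : ∀ r, ofP (toP r) = r := fun r => coords_parabolic r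
  -- the additive automorphism `T_p` of `F⁷`
  let T : (Fin 7 → F) ≃+ (Fin 7 → F) :=
    { toFun := fun r => ofP (P * toP r * Q)
      invFun := fun r => ofP (Q * toP r * P)
      left_inv := fun r => by
        show ofP (Q * toP (ofP (P * toP r * Q)) * P) = r
        rw [htoP_ofP _ (hconjP r), ← Matrix.mul_assoc, ← Matrix.mul_assoc, hQP, Matrix.one_mul, Matrix.mul_assoc, hQP, Matrix.mul_one,
          hofP_toP]
      right_inv := fun r => by
        show ofP (P * toP (ofP (Q * toP r * P)) * Q) = r
        rw [htoP_ofP _ (hconjQ r), ← Matrix.mul_assoc, ← Matrix.mul_assoc, hPQ, Matrix.one_mul, Matrix.mul_assoc, hPQ, Matrix.mul_one,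
          hofP_toP]
      map_add' := fun r s => by
        show ofP (P * toP (r + s) * Q) = ofP (P * toP r * Q) + ofP (P * toP s * Q)
        have hadd : toP (r + s) = toP r + toP s := (parabolic_add r s).symm
        rw [hadd, Matrix.mul_add, Matrix.add_mul]
        funext i
        fin_cases i <;> simp [hofP] }
  have hT : (T : (Fin 7 → F) → (Fin 7 → F)) = fun r => ofP (P * toP r * Q) := rfl
  have hTc : Continuous T := by
    rw [hT]
    exact continuous_coords.comp ((continuous_const.matrix_mul continuous_parabolic).matrix_mul continuous_const)
  have hTsc : Continuous T.symm := by
    show Continuous fun r => ofP (Q * toP r * P)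
    exact continuous_coords.comp ((continuous_const.matrix_mul continuous_parabolic).matrix_mul continuous_const)
  haveI : ((Measure.pi fun _ : Fin 7 => dx).map T).IsAddHaarMeasure := AddEquiv.isAddHaarMeasure_map _ T hTc hTsc
  -- uniqueness: `T_* (pi dx) = c • pi dx`
  have huniq := isAddLeftInvariant_eq_smul ((Measure.pi fun _ : Fin 7 => dx).map T) (Measure.pi fun _ : Fin 7 => dx)
  set c : ℝ≥0 := addHaarScalarFactor ((Measure.pi fun _ : Fin 7 => dx).map T) (Measure.pi fun _ : Fin 7 => dx) with hc_def
  -- the integer box `𝒪⁷`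
  set B : Set (Fin 7 → F) := {r | ∀ i, r i ∈ primePowBall F 0} with hB
  have hBo : IsOpen B := by
    have : B = Set.pi Set.univ (fun _ : Fin 7 => primePowBall F 0) := by ext r; simp [hB]
    rw [this]
    exact isOpen_set_pi Set.finite_univ fun _ _ => isOpen_primePowBall 0
  have hBc : IsCompact B := by
    have : B = Set.pi Set.univ (fun _ : Fin 7 => primePowBall F 0) := by ext r; simp [hB]
    rw [this]
    exact isCompact_univ_pi fun _ => isCompact_primePowBall 0
  have hB0 : (0 : Fin 7 → F) ∈ B := fun _ => zero_mem_primePowBall 0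
  have hBpos : (Measure.pi fun _ : Fin 7 => dx) B ≠ 0 := (hBo.measure_pos _ ⟨0, hB0⟩).ne'
  have hBfin : (Measure.pi fun _ : Fin 7 => dx) B ≠ ∞ := hBc.measure_lt_top.ne
  -- `Ad` of an integral block matrix preserves integrality of the coordinates
  obtain ⟨hp1, hp2⟩ := (mem_glInt_iff p).1 hp
  have hint : ∀ {A C : Matrix (Fin 3) (Fin 3) F}, (∀ i j, A i j ∈ 𝒪[F]) → (∀ i j, C i j ∈ 𝒪[F]) → ∀ r ∈ B, ofP (A * toP r * C) ∈ B := by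
    intro A C hA hC r hr
    have htoPr : ∀ i j, toP r i j ∈ 𝒪[F] := by
      intro i j
      have hr' : ∀ k, r k ∈ 𝒪[F] := fun k => (LocalFieldHaar.mem_primePowBall_zero_iff).1 (hr k)
      fin_cases i <;> fin_cases j <;> simp [htoP, hr', zero_mem]
    have hprod : ∀ i j, (A * toP r * C) i j ∈ 𝒪[F] := by
      intro i j
      simp only [Matrix.mul_apply]
      exact sum_mem fun l _ => mul_mem (sum_mem fun m _ => mul_mem (hA i m) (htoPr m l)) (hC l j)
    intro k
    rw [LocalFieldHaar.mem_primePowBall_zero_iff]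
    fin_cases k <;> simp [hofP, hprod]
  have hpre : T ⁻¹' B = B := by
    ext r
    simp only [Set.mem_preimage]
    refine ⟨fun h => ?_, fun h => hint hp1 hp2 r h⟩
    have h' : T.symm (T r) ∈ B := hint hp2 hp1 (T r) h
    rwa [AddEquiv.symm_apply_apply] at h'
  have hval : ((Measure.pi fun _ : Fin 7 => dx).map T) B = (Measure.pi fun _ : Fin 7 => dx) B := by
    rw [Measure.map_apply hTc.measurable hBo.measurableSet, hpre]
  rw [huniq, Measure.coe_nnreal_smul_apply] at hval
  have hc1 : (c : ℝ≥0∞) = 1 := (ENNReal.mul_left_inj hBpos hBfin).1 (by rw [one_mul]; exact hval)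
  rw [ENNReal.coe_eq_one] at hc1
  have hfin : (Measure.pi fun _ : Fin 7 => dx).map T = Measure.pi fun _ : Fin 7 => dx := by rw [huniq, hc1, one_smul]
  -- `T` is the map of the statement
  have hTeq : (T : (Fin 7 → F) → (Fin 7 → F)) = fun r : Fin 7 → F =>
      (![((p : Matrix (Fin 3) (Fin 3) F) * !![r 0, r 1, r 2; r 3, r 4, r 5; 0, 0, r 6] * ((p⁻¹ : GL (Fin 3) F) : Matrix (Fin 3) (Fin 3) F)) 0 0,
         ((p : Matrix (Fin 3) (Fin 3) F) * !![r 0, r 1, r 2; r 3, r 4, r 5; 0, 0, r 6] * ((p⁻¹ : GL (Fin 3) F) : Matrix (Fin 3) (Fin 3) F)) 0 1,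
         ((p : Matrix (Fin 3) (Fin 3) F) * !![r 0, r 1, r 2; r 3, r 4, r 5; 0, 0, r 6] * ((p⁻¹ : GL (Fin 3) F) : Matrix (Fin 3) (Fin 3) F)) 0 2,
         ((p : Matrix (Fin 3) (Fin 3) F) * !![r 0, r 1, r 2; r 3, r 4, r 5; 0, 0, r 6] * ((p⁻¹ : GL (Fin 3) F) : Matrix (Fin 3) (Fin 3) F)) 1 0,
         ((p : Matrix (Fin 3) (Fin 3) F) * !![r 0, r 1, r 2; r 3, r 4, r 5; 0, 0, r 6] * ((p⁻¹ : GL (Fin 3) F) : Matrix (Fin 3) (Fin 3) F)) 1 1,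
         ((p : Matrix (Fin 3) (Fin 3) F) * !![r 0, r 1, r 2; r 3, r 4, r 5; 0, 0, r 6] * ((p⁻¹ : GL (Fin 3) F) : Matrix (Fin 3) (Fin 3) F)) 1 2,
         ((p : Matrix (Fin 3) (Fin 3) F) * !![r 0, r 1, r 2; r 3, r 4, r 5; 0, 0, r 6] * ((p⁻¹ : GL (Fin 3) F) : Matrix (Fin 3) (Fin 3) F)) 2 2] : Fin 7 → F) := rfl
  rw [← hTeq]
  exact hfin

omit dx in
/-- The coordinate map `T_p : r ↦ coords(p · P(r) · p⁻¹)` is a measurable embedding of `F⁷` (indeed a measurable equivalence with inverse `T_{p⁻¹}`) for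
block upper triangular `p` (`p 2 0 = p 2 1 = 0`). [folklore] -/
theorem measurableEmbedding_adParabolicCoord {p : GL (Fin 3) F}
    (h20 : (p : Matrix (Fin 3) (Fin 3) F) 2 0 = 0) (h21 : (p : Matrix (Fin 3) (Fin 3) F) 2 1 = 0) :
    MeasurableEmbedding (fun r : Fin 7 → F =>
      (![((p : Matrix (Fin 3) (Fin 3) F) * !![r 0, r 1, r 2; r 3, r 4, r 5; 0, 0, r 6] * ((p⁻¹ : GL (Fin 3) F) : Matrix (Fin 3) (Fin 3) F)) 0 0,
         ((p : Matrix (Fin 3) (Fin 3) F) * !![r 0, r 1, r 2; r 3, r 4, r 5; 0, 0, r 6] * ((p⁻¹ : GL (Fin 3) F) : Matrix (Fin 3) (Fin 3) F)) 0 1,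
         ((p : Matrix (Fin 3) (Fin 3) F) * !![r 0, r 1, r 2; r 3, r 4, r 5; 0, 0, r 6] * ((p⁻¹ : GL (Fin 3) F) : Matrix (Fin 3) (Fin 3) F)) 0 2,
         ((p : Matrix (Fin 3) (Fin 3) F) * !![r 0, r 1, r 2; r 3, r 4, r 5; 0, 0, r 6] * ((p⁻¹ : GL (Fin 3) F) : Matrix (Fin 3) (Fin 3) F)) 1 0,
         ((p : Matrix (Fin 3) (Fin 3) F) * !![r 0, r 1, r 2; r 3, r 4, r 5; 0, 0, r 6] * ((p⁻¹ : GL (Fin 3) F) : Matrix (Fin 3) (Fin 3) F)) 1 1,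
         ((p : Matrix (Fin 3) (Fin 3) F) * !![r 0, r 1, r 2; r 3, r 4, r 5; 0, 0, r 6] * ((p⁻¹ : GL (Fin 3) F) : Matrix (Fin 3) (Fin 3) F)) 1 2,
         ((p : Matrix (Fin 3) (Fin 3) F) * !![r 0, r 1, r 2; r 3, r 4, r 5; 0, 0, r 6] * ((p⁻¹ : GL (Fin 3) F) : Matrix (Fin 3) (Fin 3) F)) 2 2] : Fin 7 → F)) := by
  haveI : T2Space F := (isLocalField F).toT2Space
  haveI : LocallyCompactSpace F := (isLocalField F).toLocallyCompactSpace
  haveI : SecondCountableTopology F := secondCountableTopology_localField F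
  set toP : (Fin 7 → F) → Matrix (Fin 3) (Fin 3) F := fun r => !![r 0, r 1, r 2; r 3, r 4, r 5; 0, 0, r 6] with htoP
  set ofP : Matrix (Fin 3) (Fin 3) F → (Fin 7 → F) := fun X => ![X 0 0, X 0 1, X 0 2, X 1 0, X 1 1, X 1 2, X 2 2] with hofP
  set P : Matrix (Fin 3) (Fin 3) F := (p : Matrix (Fin 3) (Fin 3) F) with hPdef
  set Q : Matrix (Fin 3) (Fin 3) F := ((p⁻¹ : GL (Fin 3) F) : Matrix (Fin 3) (Fin 3) F) with hQdef
  have hQP : Q * P = 1 := by rw [hQdef, hPdef, ← Units.val_mul, inv_mul_cancel, Units.val_one]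
  have hPQ : P * Q = 1 := by rw [hQdef, hPdef, ← Units.val_mul, mul_inv_cancel, Units.val_one]
  have hPbt : P.BlockTriangular (![false, false, true] : Fin 3 → Bool) := by
    intro i j hij
    fin_cases i <;> fin_cases j <;> first | exact absurd hij (by decide) | exact h20 | exact h21
  have hQbt : Q.BlockTriangular (![false, false, true] : Fin 3 → Bool) := by
    haveI : Invertible P := p.invertible
    have h := Matrix.blockTriangular_inv_of_blockTriangular hPbt
    have hQinv : Q = P⁻¹ := by rw [hQdef, hPdef, Matrix.coe_units_inv]
    rw [hQinv]
    exact h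
  have hconjP : ∀ r, (P * toP r * Q).BlockTriangular (![false, false, true] : Fin 3 → Bool) := fun r =>
    (hPbt.mul (blockTriangular_parabolic r)).mul hQbt
  have hconjQ : ∀ r, (Q * toP r * P).BlockTriangular (![false, false, true] : Fin 3 → Bool) := fun r =>
    (hQbt.mul (blockTriangular_parabolic r)).mul hPbt
  have htoP_ofP : ∀ X : Matrix (Fin 3) (Fin 3) F, X.BlockTriangular (![false, false, true] : Fin 3 → Bool) → toP (ofP X) = X := by
    intro X hX
    obtain ⟨h0, h1⟩ := apply_two_eq_zero_of_blockTriangular hX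
    exact parabolic_of_coords h0 h1
  have hofP_toP : ∀ r, ofP (toP r) = r := fun r => coords_parabolic r
  let e : (Fin 7 → F) ≃ᵐ (Fin 7 → F) :=
    { toFun := fun r => ofP (P * toP r * Q)
      invFun := fun r => ofP (Q * toP r * P)
      left_inv := fun r => by
        show ofP (Q * toP (ofP (P * toP r * Q)) * P) = r
        rw [htoP_ofP _ (hconjP r), ← Matrix.mul_assoc, ← Matrix.mul_assoc, hQP, Matrix.one_mul, Matrix.mul_assoc, hQP, Matrix.mul_one,
          hofP_toP]
      right_inv := fun r => by
        show ofP (P * toP (ofP (Q * toP r * P)) * Q) = r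
        rw [htoP_ofP _ (hconjQ r), ← Matrix.mul_assoc, ← Matrix.mul_assoc, hPQ, Matrix.one_mul, Matrix.mul_assoc, hPQ, Matrix.mul_one,
          hofP_toP]
      measurable_toFun := (continuous_coords.comp ((continuous_const.matrix_mul continuous_parabolic).matrix_mul continuous_const)).measurable
      measurable_invFun := (continuous_coords.comp ((continuous_const.matrix_mul continuous_parabolic).matrix_mul continuous_const)).measurable }
  exact e.measurableEmbedding

/-- **Brick P″.**  For `p ∈ GL₃(𝒪)` with `p 2 0 = p 2 1 = 0` and EVERY `φ : 𝔤𝔩₃(F) → [0, ∞]`: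
`∫⁻ r : Fin 7 → F, φ (p · P(r) · p⁻¹) d(pi dx) = ∫⁻ r, φ (P(r)) d(pi dx)`, `P(r) = !![r 0, r 1, r 2; r 3, r 4, r 5; 0, 0, r 6]` (no measurability needed: the
substitution is a measurable embedding of `F⁷` preserving `pi dx`). [cite: WeilBNT1967, Ch. I §2 Cor. 2 of Thm. 3; Ch. II §2] [cite: HarishChandra1999AdmissibleDistributions, §3 p. 8] -/
theorem lintegral_pi_comp_conj_parabolic_eq {p : GL (Fin 3) F} (hp : p ∈ glInt 3 F) (h20 : (p : Matrix (Fin 3) (Fin 3) F) 2 0 = 0)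
    (h21 : (p : Matrix (Fin 3) (Fin 3) F) 2 1 = 0) (φ : Matrix (Fin 3) (Fin 3) F → ℝ≥0∞) :
    ∫⁻ r : Fin 7 → F, φ ((p : Matrix (Fin 3) (Fin 3) F) * !![r 0, r 1, r 2; r 3, r 4, r 5; 0, 0, r 6] * ((p⁻¹ : GL (Fin 3) F) : Matrix (Fin 3) (Fin 3) F))
        ∂(Measure.pi fun _ : Fin 7 => dx) =
      ∫⁻ r : Fin 7 → F, φ (!![r 0, r 1, r 2; r 3, r 4, r 5; 0, 0, r 6]) ∂(Measure.pi fun _ : Fin 7 => dx) := by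
  haveI : T2Space F := (isLocalField F).toT2Space
  haveI : LocallyCompactSpace F := (isLocalField F).toLocallyCompactSpace
  haveI : SecondCountableTopology F := secondCountableTopology_localField F
  have hemb := measurableEmbedding_adParabolicCoord (F := F) h20 h21
  have hmp : MeasurePreserving (fun r : Fin 7 → F =>
      (![((p : Matrix (Fin 3) (Fin 3) F) * !![r 0, r 1, r 2; r 3, r 4, r 5; 0, 0, r 6] * ((p⁻¹ : GL (Fin 3) F) : Matrix (Fin 3) (Fin 3) F)) 0 0,
         ((p : Matrix (Fin 3) (Fin 3) F) * !![r 0, r 1, r 2; r 3, r 4, r 5; 0, 0, r 6] * ((p⁻¹ : GL (Fin 3) F) : Matrix (Fin 3) (Fin 3) F)) 0 1,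
         ((p : Matrix (Fin 3) (Fin 3) F) * !![r 0, r 1, r 2; r 3, r 4, r 5; 0, 0, r 6] * ((p⁻¹ : GL (Fin 3) F) : Matrix (Fin 3) (Fin 3) F)) 0 2,
         ((p : Matrix (Fin 3) (Fin 3) F) * !![r 0, r 1, r 2; r 3, r 4, r 5; 0, 0, r 6] * ((p⁻¹ : GL (Fin 3) F) : Matrix (Fin 3) (Fin 3) F)) 1 0,
         ((p : Matrix (Fin 3) (Fin 3) F) * !![r 0, r 1, r 2; r 3, r 4, r 5; 0, 0, r 6] * ((p⁻¹ : GL (Fin 3) F) : Matrix (Fin 3) (Fin 3) F)) 1 1,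
         ((p : Matrix (Fin 3) (Fin 3) F) * !![r 0, r 1, r 2; r 3, r 4, r 5; 0, 0, r 6] * ((p⁻¹ : GL (Fin 3) F) : Matrix (Fin 3) (Fin 3) F)) 1 2,
         ((p : Matrix (Fin 3) (Fin 3) F) * !![r 0, r 1, r 2; r 3, r 4, r 5; 0, 0, r 6] * ((p⁻¹ : GL (Fin 3) F) : Matrix (Fin 3) (Fin 3) F)) 2 2] : Fin 7 → F)) (Measure.pi fun _ : Fin 7 => dx) (Measure.pi fun _ : Fin 7 => dx) :=
    ⟨hemb.measurable, map_adParabolicCoord_eq_self dx hp h20 h21⟩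
  have hbt : ∀ r : Fin 7 → F, ((p : Matrix (Fin 3) (Fin 3) F) * !![r 0, r 1, r 2; r 3, r 4, r 5; 0, 0, r 6] *
      ((p⁻¹ : GL (Fin 3) F) : Matrix (Fin 3) (Fin 3) F)).BlockTriangular (![false, false, true] : Fin 3 → Bool) := by
    intro r
    have hPbt : (p : Matrix (Fin 3) (Fin 3) F).BlockTriangular (![false, false, true] : Fin 3 → Bool) := by
      intro i j hij
      fin_cases i <;> fin_cases j <;> first | exact absurd hij (by decide) | exact h20 | exact h21
    haveI : Invertible (p : Matrix (Fin 3) (Fin 3) F) := p.invertible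
    have hQbt : ((p⁻¹ : GL (Fin 3) F) : Matrix (Fin 3) (Fin 3) F).BlockTriangular (![false, false, true] : Fin 3 → Bool) := by
      rw [Matrix.coe_units_inv]
      exact Matrix.blockTriangular_inv_of_blockTriangular hPbt
    exact (hPbt.mul (blockTriangular_parabolic r)).mul hQbt
  have hφ : ∀ r : Fin 7 → F, φ ((p : Matrix (Fin 3) (Fin 3) F) * !![r 0, r 1, r 2; r 3, r 4, r 5; 0, 0, r 6] * ((p⁻¹ : GL (Fin 3) F) : Matrix (Fin 3) (Fin 3) F)) =
      (φ ∘ fun r : Fin 7 → F => (!![r 0, r 1, r 2; r 3, r 4, r 5; 0, 0, r 6] : Matrix (Fin 3) (Fin 3) F)) ((fun r : Fin 7 → F =>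
      (![((p : Matrix (Fin 3) (Fin 3) F) * !![r 0, r 1, r 2; r 3, r 4, r 5; 0, 0, r 6] * ((p⁻¹ : GL (Fin 3) F) : Matrix (Fin 3) (Fin 3) F)) 0 0,
         ((p : Matrix (Fin 3) (Fin 3) F) * !![r 0, r 1, r 2; r 3, r 4, r 5; 0, 0, r 6] * ((p⁻¹ : GL (Fin 3) F) : Matrix (Fin 3) (Fin 3) F)) 0 1,
         ((p : Matrix (Fin 3) (Fin 3) F) * !![r 0, r 1, r 2; r 3, r 4, r 5; 0, 0, r 6] * ((p⁻¹ : GL (Fin 3) F) : Matrix (Fin 3) (Fin 3) F)) 0 2,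
         ((p : Matrix (Fin 3) (Fin 3) F) * !![r 0, r 1, r 2; r 3, r 4, r 5; 0, 0, r 6] * ((p⁻¹ : GL (Fin 3) F) : Matrix (Fin 3) (Fin 3) F)) 1 0,
         ((p : Matrix (Fin 3) (Fin 3) F) * !![r 0, r 1, r 2; r 3, r 4, r 5; 0, 0, r 6] * ((p⁻¹ : GL (Fin 3) F) : Matrix (Fin 3) (Fin 3) F)) 1 1,
         ((p : Matrix (Fin 3) (Fin 3) F) * !![r 0, r 1, r 2; r 3, r 4, r 5; 0, 0, r 6] * ((p⁻¹ : GL (Fin 3) F) : Matrix (Fin 3) (Fin 3) F)) 1 2,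
         ((p : Matrix (Fin 3) (Fin 3) F) * !![r 0, r 1, r 2; r 3, r 4, r 5; 0, 0, r 6] * ((p⁻¹ : GL (Fin 3) F) : Matrix (Fin 3) (Fin 3) F)) 2 2] : Fin 7 → F)) r) := by
    intro r
    obtain ⟨h0, h1⟩ := apply_two_eq_zero_of_blockTriangular (hbt r)
    exact (congrArg φ (parabolic_of_coords h0 h1)).symm
  simp_rw [hφ]
  exact hmp.lintegral_comp_emb hemb _

/-- **Brick P″, Bochner form**: `∫ r, φ (p · P(r) · p⁻¹) d(pi dx) = ∫ r, φ (P(r)) d(pi dx)` for every `φ` with values in a real Banach space.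
[cite: WeilBNT1967, Ch. I §2 Cor. 2 of Thm. 3; Ch. II §2] -/
theorem integral_pi_comp_conj_parabolic_eq {E : Type*} [NormedAddCommGroup E] [NormedSpace ℝ E] {p : GL (Fin 3) F} (hp : p ∈ glInt 3 F)
    (h20 : (p : Matrix (Fin 3) (Fin 3) F) 2 0 = 0) (h21 : (p : Matrix (Fin 3) (Fin 3) F) 2 1 = 0) (φ : Matrix (Fin 3) (Fin 3) F → E) :
    ∫ r : Fin 7 → F, φ ((p : Matrix (Fin 3) (Fin 3) F) * !![r 0, r 1, r 2; r 3, r 4, r 5; 0, 0, r 6] * ((p⁻¹ : GL (Fin 3) F) : Matrix (Fin 3) (Fin 3) F))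
        ∂(Measure.pi fun _ : Fin 7 => dx) =
      ∫ r : Fin 7 → F, φ (!![r 0, r 1, r 2; r 3, r 4, r 5; 0, 0, r 6]) ∂(Measure.pi fun _ : Fin 7 => dx) := by
  haveI : T2Space F := (isLocalField F).toT2Space
  haveI : LocallyCompactSpace F := (isLocalField F).toLocallyCompactSpace
  haveI : SecondCountableTopology F := secondCountableTopology_localField F
  have hemb := measurableEmbedding_adParabolicCoord (F := F) h20 h21
  have hmp : MeasurePreserving (fun r : Fin 7 → F =>
      (![((p : Matrix (Fin 3) (Fin 3) F) * !![r 0, r 1, r 2; r 3, r 4, r 5; 0, 0, r 6] * ((p⁻¹ : GL (Fin 3) F) : Matrix (Fin 3) (Fin 3) F)) 0 0,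
         ((p : Matrix (Fin 3) (Fin 3) F) * !![r 0, r 1, r 2; r 3, r 4, r 5; 0, 0, r 6] * ((p⁻¹ : GL (Fin 3) F) : Matrix (Fin 3) (Fin 3) F)) 0 1,
         ((p : Matrix (Fin 3) (Fin 3) F) * !![r 0, r 1, r 2; r 3, r 4, r 5; 0, 0, r 6] * ((p⁻¹ : GL (Fin 3) F) : Matrix (Fin 3) (Fin 3) F)) 0 2,
         ((p : Matrix (Fin 3) (Fin 3) F) * !![r 0, r 1, r 2; r 3, r 4, r 5; 0, 0, r 6] * ((p⁻¹ : GL (Fin 3) F) : Matrix (Fin 3) (Fin 3) F)) 1 0,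
         ((p : Matrix (Fin 3) (Fin 3) F) * !![r 0, r 1, r 2; r 3, r 4, r 5; 0, 0, r 6] * ((p⁻¹ : GL (Fin 3) F) : Matrix (Fin 3) (Fin 3) F)) 1 1,
         ((p : Matrix (Fin 3) (Fin 3) F) * !![r 0, r 1, r 2; r 3, r 4, r 5; 0, 0, r 6] * ((p⁻¹ : GL (Fin 3) F) : Matrix (Fin 3) (Fin 3) F)) 1 2,
         ((p : Matrix (Fin 3) (Fin 3) F) * !![r 0, r 1, r 2; r 3, r 4, r 5; 0, 0, r 6] * ((p⁻¹ : GL (Fin 3) F) : Matrix (Fin 3) (Fin 3) F)) 2 2] : Fin 7 → F)) (Measure.pi fun _ : Fin 7 => dx) (Measure.pi fun _ : Fin 7 => dx) :=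
    ⟨hemb.measurable, map_adParabolicCoord_eq_self dx hp h20 h21⟩
  have hbt : ∀ r : Fin 7 → F, ((p : Matrix (Fin 3) (Fin 3) F) * !![r 0, r 1, r 2; r 3, r 4, r 5; 0, 0, r 6] *
      ((p⁻¹ : GL (Fin 3) F) : Matrix (Fin 3) (Fin 3) F)).BlockTriangular (![false, false, true] : Fin 3 → Bool) := by
    intro r
    have hPbt : (p : Matrix (Fin 3) (Fin 3) F).BlockTriangular (![false, false, true] : Fin 3 → Bool) := by
      intro i j hij
      fin_cases i <;> fin_cases j <;> first | exact absurd hij (by decide) | exact h20 | exact h21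
    haveI : Invertible (p : Matrix (Fin 3) (Fin 3) F) := p.invertible
    have hQbt : ((p⁻¹ : GL (Fin 3) F) : Matrix (Fin 3) (Fin 3) F).BlockTriangular (![false, false, true] : Fin 3 → Bool) := by
      rw [Matrix.coe_units_inv]
      exact Matrix.blockTriangular_inv_of_blockTriangular hPbt
    exact (hPbt.mul (blockTriangular_parabolic r)).mul hQbt
  have hφ : ∀ r : Fin 7 → F, φ ((p : Matrix (Fin 3) (Fin 3) F) * !![r 0, r 1, r 2; r 3, r 4, r 5; 0, 0, r 6] * ((p⁻¹ : GL (Fin 3) F) : Matrix (Fin 3) (Fin 3) F)) =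
      (φ ∘ fun r : Fin 7 → F => (!![r 0, r 1, r 2; r 3, r 4, r 5; 0, 0, r 6] : Matrix (Fin 3) (Fin 3) F)) ((fun r : Fin 7 → F =>
      (![((p : Matrix (Fin 3) (Fin 3) F) * !![r 0, r 1, r 2; r 3, r 4, r 5; 0, 0, r 6] * ((p⁻¹ : GL (Fin 3) F) : Matrix (Fin 3) (Fin 3) F)) 0 0,
         ((p : Matrix (Fin 3) (Fin 3) F) * !![r 0, r 1, r 2; r 3, r 4, r 5; 0, 0, r 6] * ((p⁻¹ : GL (Fin 3) F) : Matrix (Fin 3) (Fin 3) F)) 0 1,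
         ((p : Matrix (Fin 3) (Fin 3) F) * !![r 0, r 1, r 2; r 3, r 4, r 5; 0, 0, r 6] * ((p⁻¹ : GL (Fin 3) F) : Matrix (Fin 3) (Fin 3) F)) 0 2,
         ((p : Matrix (Fin 3) (Fin 3) F) * !![r 0, r 1, r 2; r 3, r 4, r 5; 0, 0, r 6] * ((p⁻¹ : GL (Fin 3) F) : Matrix (Fin 3) (Fin 3) F)) 1 0,
         ((p : Matrix (Fin 3) (Fin 3) F) * !![r 0, r 1, r 2; r 3, r 4, r 5; 0, 0, r 6] * ((p⁻¹ : GL (Fin 3) F) : Matrix (Fin 3) (Fin 3) F)) 1 1,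
         ((p : Matrix (Fin 3) (Fin 3) F) * !![r 0, r 1, r 2; r 3, r 4, r 5; 0, 0, r 6] * ((p⁻¹ : GL (Fin 3) F) : Matrix (Fin 3) (Fin 3) F)) 1 2,
         ((p : Matrix (Fin 3) (Fin 3) F) * !![r 0, r 1, r 2; r 3, r 4, r 5; 0, 0, r 6] * ((p⁻¹ : GL (Fin 3) F) : Matrix (Fin 3) (Fin 3) F)) 2 2] : Fin 7 → F)) r) := by
    intro r
    obtain ⟨h0, h1⟩ := apply_two_eq_zero_of_blockTriangular (hbt r)
    exact (congrArg φ (parabolic_of_coords h0 h1)).symm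
  simp_rw [hφ]
  exact hmp.integral_comp hemb _

end LocalField

end Summit.HodgeConjecture.HodgeConjecture.Cruxes.H413.K2E3GL3ParabolicLieAdInvariant

end
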